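import Literature.Topology.FourManifolds.SurfaceGroupNielsenCoreCasePPaAux
import Literature.Topology.FourManifolds.SurfaceGroupNielsenCoreNoDoublePoint
import HarnessLib

/-!
# Nielsen's theorem, pillar CORE: a double point at the portals of two symbols, partners inside

Topic `Literature/Topology/FourManifolds`.  The case of the case analysis of a double point
`a < b` on the closed path of a potential-minimal configuration (Zieschang–Vogt–Coldewey, LNM 835,
proof of Thm. 5.3.2 with Lemma 5.3.4, in the minimal-counterexample recasting of
`SurfaceGroupNielsenCoreFrame.lean`) in which both cuts are portals of two different symbols —
`a` cuts the kernel of `k` between the slots `sa - 1 | sa` of its value `V` (`|V| = n`), `b` cuts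
the kernel of `k'` between the slots `sb - 1 | sb` of its value `V'` (`|V'| = n'`), `k' ≠ k̄` —
and BOTH partner occurrences `k̄`, `k̄'` are INSIDE the subloop `[a, b)`.

The crossing edges of the fixation are the formal edges at the pre-cut slots `(k, q)`, `q < sa`,
whose far ends are tail slots of `k̄` of level `q`, and the formal edges at the post-cut slots
`(k', q')`, `sb ≤ q'`, whose far ends are head slots of `k̄'` of level `n' - 1 - q'`
(`SurfaceGroupNielsenCoreSides.lean`).  The parity principle (`ppa_levels_match`) gives
`sa = n' - sb` and puts the two edges of each level on one component, where a tail and a head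
carry inverse letters; hence `V'[sb, n') = (V[0, sa))⁻¹`, the translation identity
`E_{k'+1} = E_k` of the start vertices, and the block of occurrences `k, …, k'` has trivial
value.  It is symbol-closed (Claim (A)), so it decomposes the relator — unless it is the whole
word, in which case the wrap junction `k' | k` of the closed path would cancel.

## References

* H. Zieschang, E. Vogt, H.-D. Coldewey, *Surfaces and Planar Discontinuous Groups*, LNM 835
  (1980), proof of Thm. 5.3.2 and Lemma 5.3.4. [ZieschangVogtColdewey1980]
-/

noncomputable section

namespace Literature.Topology.FourManifolds

open Literature.GroupTheory.CombinatorialGroupTheory CycFactors List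

namespace SurfaceGroup

namespace Config

variable {g : ℕ} {φ : surfaceGen g → SurfaceGroup g}

section PPii

variable (hg : 2 ≤ g) (hK : RelatorKilled φ) (hI : Indecomposable φ) (hM : MarkedNontrivial φ)
  (κ : Config φ) (hmin : κ.IsMin) (d : κ.DoublePoint)
include hg hK hI hM hmin

omit hK in
/-- **No double point at the portals of two symbols with both partners inside.**
[cite: ZieschangVogtColdewey1980, proof of Thm. 5.3.2 and Lemma 5.3.4] -/
theorem false_of_doublePoint_PP_ii {k k' : ℕ} (hPa : κ.PortalAt d.a k) (hPb : κ.PortalAt d.b k')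
    (hkk' : k' ≠ κ.bar k) (hk : κ.Inside d.a d.b (κ.bar k)) (hk' : κ.Inside d.a d.b (κ.bar k')) :
    False := by
  have hg1 : 1 ≤ g := by omega
  have hN := κ.cycNielsen_U hg1 hI hM hmin
  have hU := κ.U_ne_nil hg1
  have hbar := κ.isPairing_bar
  have hab := d.lt
  have hbℓ := d.lt_length
  have hkm : k < κ.w.length := κ.lt_length_of_portalAt hPa (hab.trans hbℓ).le
  have hk'm : k' < κ.w.length := κ.lt_length_of_portalAt hPb hbℓ.le
  have hkU : k < κ.U.length := by rw [length_U]; exact hkm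
  have hk'U : k' < κ.U.length := by rw [length_U]; exact hk'm
  have hbb : κ.bar (κ.bar k) = k := κ.bar_bar hkm
  have hbb' : κ.bar (κ.bar k') = k' := κ.bar_bar hk'm
  have ha1 := hPa.1
  have ha2 := hPa.2
  have hb1 := hPb.1
  have hb2 := hPb.2
  have hki1 := hk.1
  have hki2 := hk.2
  have hk'i1 := hk'.1
  have hk'i2 := hk'.2
  -- the order of the four occurrences: `k < k̄ < k'`, `k < k̄' < k'`
  have h1 : k < κ.bar k := (κ.Kstart_lt_Kstart_iff hg1 hI hM hmin).1 (by omega)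
  have h2 : κ.bar k < k' := by
    by_contra hle
    have := κ.Kend_le_Kend (not_lt.1 hle)
    have := κ.Kstart_lt_Kend hg1 hI hM hmin (κ.bar k)
    omega
  have h3 : k < κ.bar k' := (κ.Kstart_lt_Kstart_iff hg1 hI hM hmin).1 (by omega)
  have h4 : κ.bar k' < k' := by
    by_contra hle
    have := κ.Kend_le_Kend (not_lt.1 hle)
    have := κ.Kstart_lt_Kend hg1 hI hM hmin (κ.bar k')
    omega
  have hkk : k < k' := h1.trans h2
  have hsep : ∀ j, ¬ (κ.PortalAt d.a j ∧ κ.PortalAt d.b j) := by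
    rintro j ⟨hja, hjb⟩
    have e1 := κ.portalAt_unique hja hPa
    have e2 := κ.portalAt_unique hjb hPb
    omega
  have hP2 := DoublePoint.kpos_mem_iff_of_chainEnd κ hg1 hI hM hmin d
  -- numerical data of `k` and `k'`
  set n := (fac κ.U k).length with hn
  set n' := (fac κ.U k').length with hn'
  set c₁ := jc κ.U (cpred κ.U k) with hc₁
  set c₂ := jc κ.U k with hc₂
  set c₂' := jc κ.U k' with hc₂'
  have hcc : c₁ + c₂ < n := hN.jc_add_jc_lt hU k
  have hcc' : jc κ.U (cpred κ.U k') + c₂' < n' := hN.jc_add_jc_lt hU k'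
  set sa := κ.slotAt k d.a with hsa
  set sb := κ.slotAt k' d.b with hsb
  obtain ⟨hc₁sa, hsan⟩ := κ.slotAt_bounds_of_portalAt hg1 hI hM hmin hPa
  obtain ⟨hc₁sb, hsbn⟩ := κ.slotAt_bounds_of_portalAt hg1 hI hM hmin hPb
  have hnbar : (fac κ.U (κ.bar k)).length = n := hbar.length_fac_bar hkU
  have hnbar' : (fac κ.U (κ.bar k')).length = n' := hbar.length_fac_bar hk'U
  -- the side function and (P2)
  let s : ℕ × ℕ → Bool := fun σ => decide (κ.SideIn d.a d.b σ)
  have hP2s : ∀ τ, IsKernelSlot κ.U τ → s τ = s (chainEnd κ.U κ.bar τ) := fun τ hτ =>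
    κ.decide_sideIn_eq_decide_sideIn_chainEnd hg1 hI hM hmin hab hsep hP2 hτ
  -- the crossing formal edges at the slots of `k` and of `k'`
  have hXk : ∀ q, IsCrossing s (fedge κ.U κ.bar (k, q)) ↔ q < sa := fun q =>
    isCrossing_fedge.trans ((κ.fcross_iff_decide_ne _ _ _).symm.trans
      (κ.fcross_iff_of_portalAt_left_of_inside hsep hPa hk q))
  have hXk' : ∀ q, IsCrossing s (fedge κ.U κ.bar (k', q)) ↔ sb ≤ q := fun q =>
    isCrossing_fedge.trans ((κ.fcross_iff_decide_ne _ _ _).symm.trans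
      (κ.fcross_iff_of_portalAt_right_of_inside hsep hPb hk' q))
  -- their cancelled ends: tails of `k̄` of level `q`, heads of `k̄'` of level `n' - 1 - q`
  have hTk : ∀ q, q < sa → IsTailSlot κ.U (fpartner κ.U κ.bar (k, q)) := fun q hq =>
    κ.isTailSlot_of_portalAt_left_of_inside hg1 hI hM hmin hP2 hkm hPa hk hq
  have hHk' : ∀ q, sb ≤ q → q < n' → IsHeadSlot κ.U (fpartner κ.U κ.bar (k', q)) := fun q hq hqn =>
    κ.isHeadSlot_of_portalAt_right_of_inside hg1 hI hM hmin hP2 hk'm hPb hk' hq hqn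
  have hLk : ∀ q, q < sa → level κ.U (fpartner κ.U κ.bar (k, q)) = q := fun q hq => by
    rw [(hTk q hq).level_eq hN]
    simp only [fpartner, hnbar]
    omega
  have hLk' : ∀ q, sb ≤ q → q < n' → level κ.U (fpartner κ.U κ.bar (k', q)) = n' - 1 - q :=
    fun q hq hqn => by
    rw [(hHk' q hq hqn).level_eq hN]
    simp only [fpartner, ← hn']
  -- PARITY: `sa = n' - sb`, and the two crossing edges of level `e < sa` share a component
  obtain ⟨hsasb, hpair⟩ := ppa_levels_match (E₁ := fun e => fedge κ.U κ.bar (k, e))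
    (E₂ := fun e => fedge κ.U κ.bar (k', n' - 1 - e)) (A := sa) (B := n' - sb) hN hU hbar hP2s
    (fun e he => ⟨isEdge_fedge ⟨hkU, by simp only; omega⟩, (hXk e).2 he,
      fpartner κ.U κ.bar (k, e), mem_fedge.2 (Or.inr rfl), hLk e he⟩)
    (fun e he => ⟨isEdge_fedge ⟨hk'U, by simp only; omega⟩, (hXk' _).2 (by omega),
      fpartner κ.U κ.bar (k', n' - 1 - e), mem_fedge.2 (Or.inr rfl),
      by rw [hLk' _ (by omega) (by omega)]; omega⟩)
    (fun ε hε hc => by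
      rcases κ.ppa_crossing_edge_cases hg1 hI hM hmin hab hbℓ hsep hP2 hPa hPb hε hc with
        ⟨q, hqn, -, rfl⟩ | ⟨q, hqn, -, rfl⟩
      · exact Or.inl ⟨q, (hXk q).1 hc, rfl⟩
      · have hq : sb ≤ q := (hXk' q).1 hc
        exact Or.inr ⟨n' - 1 - q, by omega, by simp only [show n' - 1 - (n' - 1 - q) = q by omega]⟩)
  -- LETTERS: `V'[n' - 1 - e] = (V[e])⁻¹` for `e < sa` (a tail and a head on one component)
  have hletter : ∀ e, e < sa →
      (fac κ.U k')[n' - 1 - e]? = ((fac κ.U k)[e]?).map fun z => (z.1, !z.2) := by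
    intro e he
    have hσ : IsSlot κ.U (k, e) := ⟨hkU, by simp only; omega⟩
    have hτ : IsSlot κ.U (k', n' - 1 - e) := ⟨hk'U, by simp only; omega⟩
    refine ppa_getElem?_of_sameComp_fpartner hN hU hbar hσ hτ
      (hpair e he _ (mem_fedge.2 (Or.inr rfl)) _ (mem_fedge.2 (Or.inr rfl))) ?_
    rw [(hTk e he).slotType_eq, (hHk' (n' - 1 - e) (by omega) (by omega)).slotType_eq hN hU]
    decide
  -- THE WORD IDENTITY: `V'[sb, n') = (V[0, sa))⁻¹`
  have hdrop : (fac κ.U k').drop sb = FreeGroup.invRev ((fac κ.U k).take sa) := by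
    refine ppa_eq_invRev_of_getElem? (by simp only [length_drop, length_take]; omega) fun i hi => ?_
    rw [length_drop] at hi
    rw [getElem?_drop, length_take, Nat.min_eq_left (by omega : sa ≤ n),
      getElem?_take_of_lt (by omega)]
    have key := hletter (sa - 1 - i) (by omega)
    rwa [show n' - 1 - (sa - 1 - i) = sb + i by omega] at key
  -- THE VERTEX IDENTITY `E_k = E_{k'+1}`
  have hva : κ.absv d.a = κ.occStart k * proj g (FreeGroup.mk ((fac κ.U k).take sa)) := by
    have e : kpos κ.U (k, sa) = d.a := κ.kpos_slotAt ha1.le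
    rw [← e]
    exact κ.absv_kpos hN hkm (by omega) (by omega)
  have hvb : κ.absv d.b = κ.occStart k' * proj g (FreeGroup.mk ((fac κ.U k').take sb)) := by
    have e : kpos κ.U (k', sb) = d.b := κ.kpos_slotAt hb1.le
    rw [← e]
    exact κ.absv_kpos hN hk'm (by omega) (by omega)
  have hvab : κ.absv d.a = κ.absv d.b := (κ.absv_eq_absv_iff _ _).2 d.pv_eq
  have hocc : κ.occStart k = κ.occStart (k' + 1) := by
    rw [← κ.occStart_mul_proj_fac hk'm, ← List.take_append_drop sb (fac κ.U k'), ← FreeGroup.mul_mk,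
      map_mul, ← mul_assoc, ← hvb, ← hvab, hva, hdrop, ← FreeGroup.inv_mk, map_inv,
      mul_inv_cancel_right]
  -- THE BLOCK `k, …, k'` is closed under the pairing
  have hblock : ∀ j, j < κ.w.length → k ≤ j → j < k' + 1 → k ≤ κ.bar j ∧ κ.bar j < k' + 1 := by
    intro j hj hj1 hj2
    rcases hj1.eq_or_lt with rfl | hkj
    · exact ⟨h1.le, by omega⟩
    rcases (Nat.le_of_lt_succ hj2).eq_or_lt with rfl | hjk'
    · exact ⟨h3.le, by omega⟩
    by_cases e1 : κ.bar j = k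
    · rw [e1]; exact ⟨le_rfl, by omega⟩
    by_cases e2 : κ.bar j = k'
    · rw [e2]; exact ⟨hkk.le, by omega⟩
    have := κ.ppa_bar_between hg1 hI hM hmin hP2 hPa hPb hj hkj hjk' e1 e2
    omega
  by_cases hwrap : k = 0 ∧ k' + 1 = κ.w.length
  · /- DEGENERATE: the block is the whole word; then the wrap junction `k' | 0` of the closed
    path would cancel: the tail cancellation `c₂'` of `k'` is the head cancellation `c₁ < sa` of
    `k = 0`, and `V'[n' - 1 - c₂'] = (V[c₂'])⁻¹`. -/
    obtain ⟨rfl, hlast⟩ := hwrap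
    have e1 : cpred κ.U 0 = k' := by unfold cpred; rw [length_U]; omega
    have hc : c₁ = c₂' := by rw [hc₁, e1]
    have hfac : fac κ.U (k' + 1) = fac κ.U 0 := by
      rw [hlast, ← length_U]
      simpa using fac_add_length κ.U 0
    have hy : (fac κ.U 0)[c₂']? = some ((fac κ.U 0)[c₂']'(by omega)) := getElem?_eq_getElem _
    set y := (fac κ.U 0)[c₂']'(by omega) with hy'
    have hlet := hletter c₂' (by omega)
    rw [hy, Option.map_some] at hlet
    have key := hN.kernel_junction hU k' (y.1, !y.2)
      (by rw [Option.mem_def, hN.getLast?_kernel hU k', show n' - c₂' - 1 = n' - 1 - c₂' by omega,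
        hlet]) y
      (by rw [Option.mem_def, hN.head?_kernel_succ hU k', hfac, hy]) rfl
    exact Bool.not_ne_self _ key
  · /- the block `k, …, k'` is a non-empty proper symbol-closed block with trivial value -/
    exact false_of_occStart_eq hI κ (j₁ := k) (j₂ := k' + 1) (by omega) (by omega) (by omega)
      (κ.blockClosed_of_bar hblock) hocc

end PPii

end Config

end SurfaceGroup

end Literature.Topology.FourManifolds

end
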